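import Summits.CriticalPhenomena.Ising3D.IsingStripL11SigmaStrips
import HarnessLib

/-!
# F-CP1, K1: the two G-objects `WL9E665G` (left face) / `WR9E666G` (right face) as typed one-box statements
(cell `crit-ising-boot`, seat typing-1 gen 4; PRE-REG v19 `045fc0704d3f2afa` §(2) K1 / AMEND-7 (O3) VERBATIM: «strip-face box := a U-1 PASS (S3) box
`Q ⊆ W₁₁` whose INTERIOR is disjoint from `U₁₁ = B₁₁ ∪ S₁₁^□`, of σ-extent `≥ 2⁻⁹`, with one full side on `∂W₁₁` (outer-face tile) or on `∂(B₁₁ ∪ S₁₁^□)`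
(inner-face tile); the K0′ box of record (rung A, interior) does NOT count unless it is one; K1 = at least ONE such box beyond the column of record with
a MANIFEST row»; lead WORD #16 / owner CONCUR C28: the objects are `WL9E665G = [101/200, 6489/12800] × [665/512, 333/256]` and
`WR9E666G = [6823/12800, 107/200] × [333/256, 667/512]`.)

STATUS OF RECORD (2026-08-29): both objects are **U-1 PASS [S3] by the cell's unit of record** — replay-1 g3 `MANIFEST.md` v0.78 sha16 `4cc05aad385ef18e`
(07:28:40Z), lead g3 K1 COUNTS LINE (HOME/STATUS 07:29:37Z): «K1 [day 14 = 2026-09-11] "at least ONE such box with a MANIFEST row" IS MET AS OF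
2026-08-29T07:28:40Z — 2 boxes». Every conjunct of WORD #13 G / R16 (4) per object: carry certificate PASS ∧ impl-1 ALL TRUE = EXPECTED ∧ impl-2 «ACCEPT»
∧ AGREE 0 ∧ i2 ACCEPT + compare 0 ∧ class column PASS (TL9 R20 / TR9 R24) ∧ leg (vi) PASS ∧ precheck v2 20/20 ∧ reader A = PASS ∧ reader B = PASS.
STANDING CAVEATS (said with the count, carried here verbatim in kind): (a) both readers are FALLBACK readings with CONTEST clauses standing (reader A =
eng-lead g51 desk under U1-G′, reader B = eng-cap-1 g85 fallback (iv)); a later owner-lane contest printing a FAIL row on the frozen script is, by K3, a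
FAIL of record on that name — then the corresponding structure below is an uncertified hypothesis and its theorem must not be cited; (b) S3, not S2
(no second-solver / kernel replay exists for these objects); (c) the kernel asserts NOTHING about either box beyond the (O3) geometry — the exclusion is
the HYPOTHESIS field; (d) K1 is a milestone of the cell's pre-registered unit, not a theorem. Filed on lead g3's WORD #18 after referee-1's READ and the
owner's GO-FILE (typing-1 g4).

WHAT IS TYPED: the (O3) GEOMETRIC clauses as a decidable predicate `StripL11.IsOuterFaceBoxQ` on rational boxes (⊆ `WQ₁₁`, apart from every box of
`BQ₁₁ :: stairFAT_v1` — hence interior disjoint from `U₁₁^□ (v1)` —, σ-extent `≥ 2⁻⁹`, one full side on `∂W₁₁`), its two instances by `decide`, and per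
object ONE hypothesis field (the S3 certificate's content, checked by two implementations + class column + readers A/B, NOT by the kernel) with the
one-box theorem `IsingEnclosure W₁₁ (W₁₁ ∖ Q)` «[kernel mod 1 S3]». HONEST FRAMING: lottery ticket; floor = tightest certified 3D Ising CFT bounds;
floating SDPB islands are not certificates; CONDITIONAL statements, never to be reported as proved facts about the 3D Ising CFT; A-mix =
`SatisfiesBootstrapAxioms` (A1–A4) VERBATIM, no `λσσε = λσεσ`, no θ-scan, no stress-tensor / twist-gap input. [folklore]
-/

namespace Summit.CriticalPhenomena.Ising3D

open Set Literature.MathematicalPhysics.QuantumFieldTheory.ConformalBootstrap3D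

namespace StripL11

/-! ### (O3) geometry as a decidable predicate -/

/-- **(O3) OUTER strip-face box, geometric half** (PRE-REG AMEND-7 (O3)), for a rational box `Q`: `Q ⊆ W₁₁` (`WQ₁₁.containsB`); `Q` apart from
every un-excluded box of record `BQ₁₁ :: stairFAT_v1` by a non-strict inequality (so its interior misses `U₁₁^□ (v1)`); σ-extent `≥ 2⁻⁹`; and one
full side on `∂W₁₁` (given `Q ⊆ W₁₁`, an edge coordinate equal to the window's). The «U-1 PASS» half of (O3) is NOT part of this predicate.
A bookkeeping definition. [folklore] -/
@[folklore] def IsOuterFaceBoxQ (Q : BoxQ) : Prop :=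
  WQ₁₁.containsB Q = true ∧ (∀ R ∈ BQ₁₁ :: stairFAT_v1, boxApartB Q R = true) ∧ (1 / 512 : ℚ) ≤ Q.σhi - Q.σlo ∧
    (Q.σlo = WQ₁₁.σlo ∨ Q.σhi = WQ₁₁.σhi ∨ Q.εlo = WQ₁₁.εlo ∨ Q.εhi = WQ₁₁.εhi)

/-- The geometric predicate implies the set-level clauses: `Q ⊆ W₁₁`. [folklore] -/
theorem IsOuterFaceBoxQ.subset_W₁₁ {Q : BoxQ} (h : IsOuterFaceBoxQ Q) : Q.toSet ⊆ W₁₁ := by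
  rw [W₁₁_eq]; exact BoxQ.toSet_subset_of_containsB h.1

/-- `A1 = WL9E665G`: the left-face box `[101/200, 6489/12800] × [665/512, 333/256]` (σ-width `2⁻⁹` W-anchored, ε-height `2⁻⁹`). [folklore] -/
def boxWL9E665G : BoxQ := ⟨101 / 200, 6489 / 12800, 665 / 512, 333 / 256⟩

/-- `A2 = WR9E666G`: the right-face box `[6823/12800, 107/200] × [333/256, 667/512]`. [folklore] -/
def boxWR9E666G : BoxQ := ⟨6823 / 12800, 107 / 200, 333 / 256, 667 / 512⟩

/-- `WL9E665G` satisfies the geometric half of (O3) (left side on `Δσ = 101/200`). `decide`. [folklore] -/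
theorem boxWL9E665G_isOuterFaceBox : IsOuterFaceBoxQ boxWL9E665G := by
  unfold IsOuterFaceBoxQ; decide +kernel

/-- `WR9E666G` satisfies the geometric half of (O3) (right side on `Δσ = 107/200`). `decide`. [folklore] -/
theorem boxWR9E666G_isOuterFaceBox : IsOuterFaceBoxQ boxWR9E666G := by
  unfold IsOuterFaceBoxQ; decide +kernel

/-- Both boxes lie beyond the column of record `ColumnFaceL11.σcell = [33957/65536, 16979/32768]` (K1: «beyond the column of record»): `WL9E665G`
ends left of it, `WR9E666G` starts right of it (rational comparison; `σcell`'s literals restated from `IsingColumnFaceL11`). [folklore] -/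
theorem k1Objects_beyond_column :
    boxWL9E665G.σhi < 33957 / 65536 ∧ (16979 / 32768 : ℚ) < boxWR9E666G.σlo := by
  simp only [boxWL9E665G, boxWR9E666G]; norm_num

/-- The same against the tree's `ColumnFaceL11.σcell` itself: both boxes are disjoint from the column `σcell × ℝ`. [folklore] -/
theorem k1Boxes_disjoint_column : ∀ Q ∈ [boxWL9E665G, boxWR9E666G], ∀ p ∈ Q.toSet, p.1 ∉ ColumnFaceL11.σcell := by
  have h : ∀ Q ∈ [boxWL9E665G, boxWR9E666G], Q.σhi < 33957 / 65536 ∨ (16979 / 32768 : ℚ) < Q.σlo := by decide +kernel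
  intro Q hQ p hp hc
  obtain ⟨h1, h2, -, -⟩ := BoxQ.bounds hp
  simp only [ColumnFaceL11.σcell, mem_Icc] at hc
  rcases h Q hQ with hs | hs
  · have hs' : ((Q.σhi : ℚ) : ℝ) < ((33957 / 65536 : ℚ) : ℝ) := by exact_mod_cast hs
    push_cast at hs'
    linarith [hc.1]
  · have hs' : (((16979 / 32768 : ℚ)) : ℝ) < ((Q.σlo : ℚ) : ℝ) := by exact_mod_cast hs
    push_cast at hs'
    linarith [hc.2]

/-! ### The certificates as HYPOTHESES and the one-box theorems -/

/-- **`WL9E665G` as a HYPOTHESIS** — the content of the Λ = 11 kind-`deriv` certificate on `[101/200, 6489/12800] × [665/512, 333/256]` once its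
obligation list holds (checked by implementations 1/2 + class column TL9 + readers A/B at box standard S3, «U-1 PASS», NOT by the kernel).
A bookkeeping definition; nothing is asserted. [folklore] -/
@[folklore] structure CertWL9E665G : Prop where
  /-- `WL9E665G` (A1 — THE K1 OBJECT; left outer-face tile, class TL9; G-object re-emission of `WL9E665` on the SAME box, lead WORD #16 / owner C28) —
  box `[101/200, 6489/12800] × [665/512, 333/256]` (σ 2⁻⁹ W-anchored × ε 2⁻⁹): certificate `certWL9E665G_deriv_v1.json` sha256
  `b8b463e16d9045ff651aad74d36eadb03835b1d49642422fb827ca6c7d726401` (ising3d-cert-v1 · deriv · mixed · Λ 11; certnom j326043, scout-1 g4; candidate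
  `802a67ab…`, t* = 1.826e-05 [float]), head layout `layout_WL9_665_v1.0.2.json` `f4e0ef031598a4c7…` (grid {sigma 512, eps 512}), region layout
  `layout_wl9e665_region_v1p2.json` `c4bb1561…` (SC_PARTS `c50101bc…`, 740 parts); ask dir `HOME/crit-ising-boot-scout-1/g16-ask/ask-T1-WL9E665G/`
  (`FILES.sha256` sha16 `5c01392b46db4fab`, 16/16; precheck v2 20/20); MANIFEST row `WL9E665G` (v0.78 `4cc05aad385ef18e`). LEGS: referee carry certificate
  PASS (layout half 05:39:06Z ∧ cert half 06:28:21Z, KILL 0) · impl-1 k0p2 j326828 ALL TRUE = EXPECTED (head 803/803, head N⁻ 4/4 FALSE, restage 740/740,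
  region 2 834/2 834 TRUE, region N⁻ 5/5 FALSE; outputs `3b19dc1aff113eb3`; tables-1 g2 07:03:37Z; referee reproduced) · impl-2 deriv-obl 1.2.19.dev0 j326830
  «ACCEPT» 1 281 records 0 FALSE 0 UNDECIDED (06:47:54Z) · AGREE 0 (`AGREEMENT-WL9E665G.json` `3b7784da…`) · i2 0.4.6 j326824 ACCEPT + compare 0
  (`COMPARE-vs-impl1-k0p2-G-j326828.tsv` `aaff7d90…`; referee three-way 795/795/795) · N⁻: head `nminusWL9E665G_v1.json` `916a8db0…` 4/4 + region
  `NMINUS_region_WL9_665_v1.json` `6198ccbc…` 5/5 rejected by all three · class column TL9 = PASS (lead R20) · leg (vi) PASS (R-CTRL-4) · precheck v2 20/20 ·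
  reader A = PASS (engines REQUESTS L7715 ask → L7717 answer, 07:06:44Z: eng-lead g51 desk FALLBACK (U1-G′)) · reader B = PASS (L7721 read-begin → L7722
  answer, 07:27:09Z: eng-cap-1 g85 FALLBACK (iv), frozen `readB_tbox_v11.py` `ffad20fa…`, 62 PASS / 0 FAIL / 4 INFO of 66; owner lane may re-run and
  ratify or contest) ⇒ U-1 PASS [S3] by the cell's unit 07:28:40Z; COUNTS (lead 07:29:37Z); S3 not S2; a contest FAIL row withdraws the count (K3).
  Disclosure of record (R-RB1-b, verbatim): «A1's first certificate `WL9E665` failed reader B on a layout-grid literal (F-T1-RB1, L7706); re-laid and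
  re-emitted as `WL9E665G`; F-RPL-1 disclosed and closed by precheck v2». -/
  bWL9E665G : BoxExcluded boxWL9E665G.toSet

/-- **`WR9E666G` as a HYPOTHESIS** (A2, class TR9) — the content of its Λ = 11 kind-`deriv` certificate once its obligation list holds (checked by
implementations 1/2 + class column TR9 + readers A/B at box standard S3, «U-1 PASS», NOT by the kernel). A bookkeeping definition; nothing is asserted. [folklore] -/
@[folklore] structure CertWR9E666G : Prop where
  /-- `WR9E666G` (A2 — right outer-face tile, class TR9; G-object re-emission of `WR9E666` on the SAME box) — box `[6823/12800, 107/200] × [333/256, 667/512]`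
  (σ 2⁻⁹ W-anchored × ε 2⁻⁹): certificate `certWR9E666G_deriv_v1.json` sha256 `6fb518a9b2ba81d04b803ec91dac8fa9a012cfec5c8dcd3ff1600ae09a44845c`
  (ising3d-cert-v1 · deriv · mixed · Λ 11; certnom j326043), head layout `layout_WR9_666_v1.0.2.json` `6d39fb768bfa5950…` (grid {sigma 512, eps 512}),
  region layout v1p2 `88b7dbb7…` (SC_PARTS `63930ce3…`, 766 parts); ask dir `HOME/crit-ising-boot-scout-1/g16-ask/ask-T1-WR9E666G/` (`FILES.sha256` sha16
  `6c7ed5de0ae6ed41`, 16/16; precheck v2 20/20); MANIFEST row `WR9E666G` (v0.78). LEGS: referee carry certificate PASS · impl-1 k0p2 j326829 ALL TRUE =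
  EXPECTED (head 803/803, N⁻ 4/4 FALSE, restage 766/766, region 3 081/3 081 TRUE, region N⁻ 5/5 FALSE; outputs `8126b4b925c1a657`) · impl-2 deriv-obl
  1.2.19.dev0 j326832 «ACCEPT» 1 281 records 0 FALSE 0 UNDECIDED · AGREE 0 (`AGREEMENT-WR9E666G.json` `b382b583…`) · i2 0.4.6 j326825 ACCEPT + compare 0
  (`COMPARE-vs-impl1-k0p2-G-j326829.tsv` `726a0703…`) · N⁻: head `c467549f…` 4/4 + region NMINUS `2fd9bfd7…` 5/5 rejected by all three · class column
  TR9 = PASS (lead R24) · leg (vi) PASS (R-CTRL-4) · precheck v2 20/20 · reader A = PASS (L7716 ask → L7718 answer, 07:08:14Z: eng-lead g51 desk FALLBACK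
  (U1-G′)) · reader B = PASS (L7721 → L7723 answer, 07:27:16Z: eng-cap-1 g85 FALLBACK (iv), 62 PASS / 0 FAIL / 4 INFO of 66; owner lane may re-run and
  ratify or contest) ⇒ U-1 PASS [S3] by the cell's unit 07:28:40Z; COUNTS (lead 07:29:37Z); S3 not S2; a contest FAIL row withdraws the count (K3).
  Disclosure: A2's first certificate `WR9E666` carried the same layout-grid literal, was never read by B, and was re-laid and re-emitted as `WR9E666G`
  before any reader-B reading. -/
  bWR9E666G : BoxExcluded boxWR9E666G.toSet

/-- Generic one-box statement: an excluded rational box `Q` gives `IsingEnclosure W₁₁ (W₁₁ ∖ Q)`. [folklore] -/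
theorem isingEnclosure_diff_of_boxExcluded (Q : BoxQ) (hQ : BoxExcluded Q.toSet) : IsingEnclosure W₁₁ (W₁₁ \ Q.toSet) :=
  isingStrip_L11_of_cover [Q] (fun p hp => by
    have h : p ∈ Q.toSet := not_not.mp fun hn => hp.2 ⟨hp.1, hn⟩
    simpa using h) (by simpa using hQ)

/-- **K1 OBJECT `WL9E665G`** — CONDITIONAL on `CertWL9E665G`: no unitary crossing-symmetric `(Δσ, Δε)` satisfying A1–A4 at Λ = 11 lies in
`W₁₁ ∩ [101/200, 6489/12800] × [665/512, 333/256]`; with `boxWL9E665G_isOuterFaceBox` this is a strip-face box in the sense of (O3). Label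
«[kernel mod 1 S3]: the kernel checks the geometry (`IsOuterFaceBoxQ` by `decide`, disjoint from the column, GFF/centre guards) and the implication; the S3 certificate is the HYPOTHESIS, asserted by no one in the kernel». [folklore] -/
theorem isingLeftFaceTile_WL9E665G (h : CertWL9E665G) : IsingEnclosure W₁₁ (W₁₁ \ boxWL9E665G.toSet) :=
  isingEnclosure_diff_of_boxExcluded _ h.bWL9E665G

/-- **`WR9E666G`** — CONDITIONAL on `CertWR9E666G`: no admissible `(Δσ, Δε)` in `W₁₁ ∩ [6823/12800, 107/200] × [333/256, 667/512]`. Label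
«[kernel mod 1 S3]: the kernel checks the geometry (`IsOuterFaceBoxQ` by `decide`, disjoint from the column, GFF/centre guards) and the implication; the S3 certificate is the HYPOTHESIS, asserted by no one in the kernel». [folklore] -/
theorem isingRightFaceTile_WR9E666G (h : CertWR9E666G) : IsingEnclosure W₁₁ (W₁₁ \ boxWR9E666G.toSet) :=
  isingEnclosure_diff_of_boxExcluded _ h.bWR9E666G

/-- **Both K1 objects together** «[kernel mod 2 S3]: geometry and implication in the kernel; the two S3 certificates are the HYPOTHESES»: no admissible
`(Δσ, Δε) ∈ W₁₁` lies in either box. [folklore] -/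
theorem isingK1Tiles_L11 (h₁ : CertWL9E665G) (h₂ : CertWR9E666G) :
    IsingEnclosure W₁₁ (W₁₁ \ (boxWL9E665G.toSet ∪ boxWR9E666G.toSet)) := by
  have h := (isingLeftFaceTile_WL9E665G h₁).inter (isingRightFaceTile_WR9E666G h₂)
  refine h.mono Subset.rfl ?_
  rintro p ⟨⟨hW, h1⟩, -, h2⟩
  exact ⟨hW, fun hu => hu.elim h1 h2⟩

/-! ### Vacuity guards -/

/-- Neither box meets the generalised-free line `(p, 2p)` (on them `Δσ ≤ 107/200`, so `2Δσ ≤ 1.07 < 665/512 ≤ Δε`): the hypotheses are not refuted by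
the tree's known A1–A4 families. [folklore] -/
theorem gffLine_not_mem_k1Boxes : ∀ Q ∈ [boxWL9E665G, boxWR9E666G], ∀ p : ℝ, (p, 2 * p) ∉ Q.toSet := by
  have h : ∀ Q ∈ [boxWL9E665G, boxWR9E666G], Q.σhi ≤ 107 / 200 ∧ (665 / 512 : ℚ) ≤ Q.εlo := by decide +kernel
  intro Q hQ p hp
  obtain ⟨hs, he⟩ := h Q hQ
  obtain ⟨-, h2, h3, -⟩ := BoxQ.bounds hp
  have hs' : ((Q.σhi : ℚ) : ℝ) ≤ ((107 / 200 : ℚ) : ℝ) := by exact_mod_cast hs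
  have he' : (((665 / 512 : ℚ)) : ℝ) ≤ ((Q.εlo : ℚ) : ℝ) := by exact_mod_cast he
  push_cast at hs' he'
  simp only at h2 h3
  linarith

/-- The one-box theorems are not vacuous: each box has interior points of `W₁₁` (its centre). [folklore] -/
theorem k1Boxes_centre_mem :
    ((6477 / 12800 : ℝ), (1331 / 1024 : ℝ)) ∈ boxWL9E665G.toSet ∩ W₁₁ ∧
      ((13671 / 25600 : ℝ), (1333 / 1024 : ℝ)) ∈ boxWR9E666G.toSet ∩ W₁₁ := by
  refine ⟨⟨mk_mem_prod ⟨?_, ?_⟩ ⟨?_, ?_⟩, mk_mem_prod ⟨?_, ?_⟩ ⟨?_, ?_⟩⟩, ⟨mk_mem_prod ⟨?_, ?_⟩ ⟨?_, ?_⟩, mk_mem_prod ⟨?_, ?_⟩ ⟨?_, ?_⟩⟩⟩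
  all_goals first | (simp only [boxWL9E665G, boxWR9E666G]; push_cast; norm_num) | norm_num

end StripL11

end Summit.CriticalPhenomena.Ising3D
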